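import Summits.ResolutionOfSingularities.ResolutionOfSingularities.Theorems.ToricLadder
import Literature.AlgebraicGeometry.Resolution.ImmediateRationalUniformization
import Literature.AlgebraicGeometry.Resolution.LocalEtaleUniformization
import Literature.AlgebraicGeometry.Resolution.KnafKuhlmann2009Prop310
import HarnessLib

/-!
# KaplanskyHensel — decomp-res node «PerronLadder» (lens-1 g17 KaplanskyLadder → g18 PerronLadder), tree file
1/11 of the node

Content VERBATIM from the decomp-res lens-1 g18 file `HOME/decomp-res-lens-1/g18/PerronLadder.lean` (sha256
8bb02ceefe11b749, 3725 l; it SUPERSEDES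
g17 `KaplanskyLadder.lean` fb35e2e5 ⊇ g16 `ToricLadder.lean` 67376591 as landing source; PARTS I–III = the
landed `Theorems/ToricLadderCells`,
`ToricLadderKernels`, `ToricLadderLinks`, `ToricLadderDense`, `ToricLadder` — not repeated).  HOME =
run/shared/lean/pub/decomp-res.  Critic:
CRITIC-LEDGER rows 131 (g17, 2026-08-30T18:47:14Z) and 138 (g18 CLEARED, landing order 2026-08-30T20:05:14Z); the
lens's WRITER.md (endorsed).
Landed by decomp-res writer g7 as SUPPORT of the Valuative route item 0641 `LuAlphaPTorsor` (helper files; no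
Valuative route edit is made by the
decomp-res cell: the support ports Σ₁ `MonoidalStep` / Π₁ `KK05NCVAscent`, the retirement of g16's all-rank
`ToricAscent 3` in favour of the theorem
`toricAscentRk1_three`, and the UNCHANGED located residual `NonKHToricArchLU 3 3 4` / port-free `NonKHArchLU 3 4`
stay documented tree definitions
for the Valuative tenure / operator to book).

PART IV (g17) §14 the Kaplansky–Hensel datum `KHTop` and its law (`KaplanskyHenselLU`, PROVED modulo the floor
from the tree's
immediate-rational / local-étale uniformization facts).  §15 the Kaplansky ladder: `KaplanskyLadder`; §16:
`KaplanskyLadderDefectless`.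

[WRITER NOTE (decomp-res writer g7): namespaces `…Theses.PerronLadder` ↦ `…Theorems.KaplanskyLadder` (PART IV
= g17 §14–§16, files
`KaplanskyLadder`, `KaplanskyLadderDefectless`) and ↦ `…Theorems.PerronLadder` (PART V, files `PerronMerge`
§17, `PerronCharts` §18–§19,
`PerronMonomialization` §20, `PerronInitialChartPrelim` + `PerronInitialChart` §21 (400-line limit),
`PerronRepresentations` §22, `PerronAscent`
§23, `PerronLadder` §24; PART IV likewise `KaplanskyHensel` §14 / `KaplanskyLadder` §15), with `open
…Theorems.ToricLadder` (+ `…KaplanskyLadder`) so the lens's unqualified references stay verbatim; `section PartV` and its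
section-scoped `open`s re-opened per file; the g16 helper `intermediateField_top_fg` is the landed
`PfaffLine.intermediateField_top_fg_of_isFractionRing`
(renamed at its use, as in the landed `ToricLadder`); global `set_option` lines dropped; nothing else changed.]

## The lens's g17 header (VERBATIM)

# (INHERITED, gen 17) KaplanskyLadder — the header of PARTS I–IV, kept verbatim

HOST (verbatim): `Summit.ResolutionOfSingularities.ResolutionOfSingularities.Theses.Valuative.LuAlphaPTorsor`
(stmt-ResolutionOfSingularities-0641, route `Valuative`, deciding theorem
`Valuative.closes (h₂ : LuAlphaPTorsor) (h₄ : TorsorToLurel) (h₃ : PatchingRel) : ResolutionOfSingularities`).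
ROOT: `_root_.ResolutionOfSingularities`.  TARGET of this generation: the gen-16 located residual
`NonToricArchLU 2 4` (rank-one, zero-dimensional, non-Abhyankar valuations of fourfold function fields that
are neither separably dense over a finitely generated subfield of transcendence degree `≤ 3` nor toric–dense
over one of transcendence degree `≤ 2`) — and, port-free, the gen-15 residual `NonSepDenseNonAbhArchLU 4`.

PARTS I–III (§§1–13) are the gen-16 node `ToricLadder` VERBATIM (file
`run/shared/lean/pub/decomp-res/decomp-res-lens-1/g16/ToricLadder.lean`, sha256
`67376591e05ef26effd8e083b9b56a68e55891167d05b786e658b6e2d9f35b77`, re-namespaced `…Theses.KaplanskyLadder`;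
not in the tree, carried to keep the node self-contained and compiling).

PART IV (§§14–16, NEW in gen 17) grades the residual by KAPLANSKY'S APPROXIMATION TYPE — the first
defect-sensitive cut on this spine.  The CELL DATUM `KHTopBelow k O c` is a KAPLANSKY–HENSEL TOP over a
finitely generated subfield `F₁` of transcendence degree `≤ c`: an element `z` transcendental over `F₁` with
`F₁(z) | F₁` IMMEDIATE and of TRANSCENDENTAL TYPE (Kaplansky's condition (3) = Knaf–Kuhlmann's (trat):
for every `g ∈ F₁[X]` the value `v g(a)` is constant on a ball of `F₁` around `z` — "no limit key polynomial
at depth one"), and a HENSEL ROOT `η ∈ O` over `O ∩ F₁(z)` with `K = F₁(z)(η)` (the finite part of the top is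
étale at the centre).  The hypotheses are typed VERBATIM as those of the tree's PROVED theorems
`isSmoothlyUniformizableIn_of_immediate_of_kaplansky` (Knaf–Kuhlmann 2009 = arXiv:math/0702856, Lemma 3.9,
with Lemma 2.17 (trat)), `isSmoothlyUniformizableIn_of_henselRoot` (Lemma 3.7 (2)) and
`knafKuhlmann2009_cor36` (Cor. 3.6), so that the LAW of the cell is a KERNEL COMPOSITION with NO port:

  `relLU_of_khTop : RelLU(F₁) → (Kaplansky–Hensel top over F₁) → RelLocalUniformization k K O`

((hB) for `O ∩ F₁` by the gen-15 transport `regularBase_of_relLU`; (hF) = Lemma 3.9 on the layer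
`F₁(z) | F₁` and Lemma 3.7 on the layer `K | F₁(z)`, stacked by Cor. 3.6; conclusion by the tree's
`PfaffLine.stub_relLU_of_regularBase` = Prop. 3.5 / Cor. 3.6 over a regular base).  In print these lemmas are
assembled only over SEPARABLY TAME base fields (KK09 Thm. 3.8 / Prop. 3.10, where tameness SUPPLIES the
datum); here the datum is the cell and the base — an ARBITRARY valued threefold function field, tame or not,
Abhyankar or not — is uniformized by the Cossart–Piltant floor.  Consequences (§15):

* cell `KaplanskyHenselLU c n` DECIDED at every rung `n` for `c ≤ 3` modulo `CossartPiltant2019LU3` ALONE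
  (`khLU_three`), in kernel;
* residuals `NonKHArchLU c n` (gen-15 residual hypotheses ∧ no Kaplansky–Hensel top with base bound `c`) and
  `NonKHToricArchLU e c n` (gen-16 residual hypotheses ∧ the same), EXACT cuts by excluded middle
  (`nonSepDenseNonAbh_iff_nonKH`, `nonToric_iff_nonKHToric`), the located residual refined PORT-FREE
  `LURel 4 ↔ NonKHArchLU 3 4` (`luRel_four_iff_nonKH`) and, with the gen-16 port, `LURel 4 ↔ NonKHToricArchLU 2 3 4`;
* ROOT BY NAME, port-free: `closes_kaplansky (hCP) (hN : ∀ d ≥ 4, NonKHArchLU 3 d) (h₃ : PatchingRel)`;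
  WEAKER certificates `khLU_of_root`, `nonKHArchLU_of_root`, `nonKHToricArchLU_of_root`, `…_of_hostCone`,
  `root_iff_nonKH`.
* §16 types the PRINTED sufficient condition for the datum's transcendental-type clause — a DEFECTLESS base
  (tree `IsDefectlessField`) and a top at bounded distance — as the bridge `TratOfDefectlessBase`
  (UNDECIDED · ATTACKABLE-MOD-PRINT — the port is Kaplansky 1942 (Duke Math. J. 9), Lemma 5 and Thm. 3, i.e.
  pseudo-convergent sequences, absent from Mathlib; the other two inputs, "defectless ⇔ henselization
  defectless" = Kuhlmann 2010 Thm. 2.14 and "rank one ⇒ dense in the henselization" = Kuhlmann 2010 Lemma 2.4,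
  are PROVED in the tree: `Kuhlmann2010DefectlessIffHenselization_holds`, `HenselizationDensity`), with the
  derived cell `DefectlessHenselLU` decided modulo floor + that bridge (`defectlessHenselLU_three`).  This is
  San Saturnino's mechanism (arXiv:1412.7697 Prop. 6.1: defectless base ⇒ no limit key polynomials) in
  function-field currency.

«Why this is novel»: every earlier cut on this spine (gens 11–16) is typed by VALUE GROUPS and DENSITY
(Abhyankar places, completion hulls, free quotients `Γ_K/Γ_{F₁}`); this one is typed by the APPROXIMATION TYPE
of the top generator and is therefore the first to separate valuations with the SAME value group, residue
field and completion behaviour: the certified inhabitant J1 (`K = k(x₁,x₂,x₃)(z)`, monomial weights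
`(1, √2, √3)`, `z` a bounded-distance pseudo-limit of transcendental type) has finitely generated `Γ_K`,
is non-Abhyankar, is NOT dense over any subfield of transcendence degree `≤ 3` and NOT toric–dense over any
surface subfield (NODE-g17.md §3, Lemmas A/B: Abhyankar lattices are dense in `k((t^Γ))^{fin}`), lies in
the gen-16 located residual, and is decided here WITHOUT the unproved `ToricAscent 3`.  «Why each piece is
strictly weaker»: cell and residuals follow from the root outright (`…_of_root`); the residual keeps the
inhabitant I3 of gen 16 (`Γ_K = ℤ[1/p](1,√2,√3)`: no immediate threefold sub-base exists), so the cut is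
proper on both sides.  The new located residual is the DEFECT LOCUS PROPER: tops whose every presentation
over a threefold subfield carries a pseudo-Cauchy sequence of ALGEBRAIC type (an Artin–Schreier defect limit,
Kuhlmann *The defect* Ex. 21) or a non-étale finite part, or is non-immediate over every threefold subfield.

Below, the gen-16 module docstring is kept verbatim as the description of PARTS I–III.

(Sources: CossartPiltant2019; CossartJannsenSaito2020; KnafKuhlmann2005 arXiv:math/0304159 §4 Thm 4.1, Lemmas
4.2–4.4; KnafKuhlmann2009 arXiv:math/0702856 Prop 3.11, Thm 1.5; Kaplansky1942 Lemma 5, Thm 3; Kuhlmann2010 Thm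
2.14; Zariski1940 §B; Cutkosky arXiv:1404.7459 §2.1; ZariskiSamuelII.)
-/

noncomputable section

open IsLocalRing Literature.AlgebraicGeometry.Resolution
open Summit.ResolutionOfSingularities.ResolutionOfSingularities.Theses
open Summit.ResolutionOfSingularities.ResolutionOfSingularities.Theorems
open Summit.ResolutionOfSingularities.ResolutionOfSingularities.Theorems.PfaffLine
open Summit.ResolutionOfSingularities.ResolutionOfSingularities.Theorems.ToricLadder

namespace Summit.ResolutionOfSingularities.ResolutionOfSingularities.Theorems.KaplanskyLadder

/-! # PART IV — the Kaplansky–Hensel cut (gen 17)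

The residual is graded by the APPROXIMATION TYPE of a top generator: a valuation of `K/k` is in the new cell
when `K` is an immediate, henselian-rational top of TRANSCENDENTAL TYPE over some finitely generated subfield
`F₁` of bounded transcendence degree — `K = F₁(z)(η)` with `F₁(z) | F₁` immediate, `z` satisfying Kaplansky's
condition (3) (Knaf–Kuhlmann 2009, Lemma 2.16/2.17, condition (trat): for every `g ∈ F₁[X]` the value
`v g(a)` is constant on a ball of `F₁` around `z`), and `η ∈ O` a simple root of a monic polynomial over
`O ∩ F₁(z)` whose derivative at `η` is a unit (a Hensel root: `O | O ∩ F₁(z)` local-étale, Lemma 3.7).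
All three printed engines are PROVED in the tree, so the law of the cell is a kernel composition. -/

/-! ## 14. The Kaplansky–Hensel datum and its law -/

section Kaplansky

variable {k K : Type} [Field k] [Field K] [Algebra k K]

variable (k) in
/-- The CELL DATUM with base bound `c` — a KAPLANSKY–HENSEL TOP: a finitely generated intermediate field
`F₁` with `tr.deg_k F₁ ≤ c` and elements `z η : K` such that
* `z` is transcendental over `F₁` (no non-zero polynomial with coefficients in `F₁` vanishes at `z`);
* `F₁(z) | F₁` is IMMEDIATE: every non-zero `w ∈ F₁(z)` has the value of an element of `F₁`, and every
  `w ∈ O ∩ F₁(z)` is congruent to an element of `F₁` modulo the maximal ideal;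
* `z` is of TRANSCENDENTAL TYPE over `F₁` — Kaplansky's condition (3) / Knaf–Kuhlmann's (trat): for every
  polynomial `g` with coefficients in `F₁` there is a ball of `F₁` around `z` on which `v (g a)` is constant;
* `η ∈ O` is a HENSEL ROOT over `O ∩ F₁(z)` generating `K`: `K = F₁(z)(η)`, `f(η) = 0` for a monic `f`
  with coefficients in `O ∩ F₁(z)` and `v (f'(η)) = 0` in additive notation (`= 1` multiplicatively).
(`η = 0`, `f = X` covers `K = F₁(z)`.)  The four clauses are, verbatim, the hypotheses `htrans`, `hval`,
`hres`, `h3` of the tree's `isSmoothlyUniformizableIn_of_immediate_of_kaplansky` (KK09 Lemma 3.9) and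
`hηV`, `hgen`, `hfmon`, `hfcoeff`, `hfη`, `hfder` of `isSmoothlyUniformizableIn_of_henselRoot` (KK09
Lemma 3.7), read with `Ω := K`, `V := O`, `K := F₁`, `L := F₁(z)`, `F := ⊤`.
[KnafKuhlmann2009 = arXiv:math/0702856: Lemma 2.16/2.17 (p. 10), Lemma 3.7, Lemma 3.9 (pp. 13–14);
Kaplansky1942 = Duke Math. J. 9 (1942) 303–321 (corpus `book:kaplanskynd-selected-papers-other-writings`):
Lemma 5 (p. 16 L41: `{f(a_ρ)}` is ultimately pseudo-convergent), Thm. 2 (p. 17 L3: a pseudo-convergent set of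
TRANSCENDENTAL TYPE without limit yields the immediate transcendental extension `K(z)` — its defining
hypothesis is condition (3) = (trat) above), Thm. 3 (p. 18 L16: algebraic type yields an immediate ALGEBRAIC
extension — the excluded case)] -/
def KHTopBelow (O : ValuationSubring K) (c : ℕ) : Prop :=
  ∃ (F₁ : IntermediateField k K) (z η : K), F₁.FG ∧ Algebra.trdeg k F₁ ≤ c ∧
    (∀ P : Polynomial K, (∀ i, P.coeff i ∈ F₁.toSubfield) → P.eval z = 0 → P = 0) ∧
    (∀ w ∈ Subfield.closure ((F₁.toSubfield : Set K) ∪ {z}), w ≠ 0 →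
      ∃ b ∈ F₁.toSubfield, O.valuation w = O.valuation b) ∧
    (∀ w ∈ Subfield.closure ((F₁.toSubfield : Set K) ∪ {z}), w ∈ O →
      ∃ c ∈ F₁.toSubfield, O.valuation (w - c) < 1) ∧
    (∀ g : Polynomial K, (∀ i, g.coeff i ∈ F₁.toSubfield) →
      ∃ a₀ ∈ F₁.toSubfield, ∃ α : O.ValueGroup, ∀ a ∈ F₁.toSubfield,
        O.valuation (z - a) ≤ O.valuation (z - a₀) → O.valuation (g.eval a) = α) ∧
    η ∈ O ∧
    Subfield.closure (((Subfield.closure ((F₁.toSubfield : Set K) ∪ {z}) : Subfield K) : Set K) ∪ {η})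
      = ⊤ ∧
    ∃ f : Polynomial K, f.Monic ∧
      (∀ i, f.coeff i ∈ O ∧ f.coeff i ∈ Subfield.closure ((F₁.toSubfield : Set K) ∪ {z})) ∧
      f.eval η = 0 ∧ O.valuation ((Polynomial.derivative f).eval η) = 1

/-- Raising the base bound enlarges the datum. [folklore] -/
theorem khTopBelow_mono (O : ValuationSubring K) {c c' : ℕ} (hcc : c ≤ c') (h : KHTopBelow k O c) :
    KHTopBelow k O c' := by
  obtain ⟨F₁, z, η, hfg, htr, hrest⟩ := h
  exact ⟨F₁, z, η, hfg, htr.trans (by exact_mod_cast hcc), hrest⟩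

/-- **K15 · THE KAPLANSKY–HENSEL LAW (kernel, port-free).**  Characteristic-free and base-free: if the
valued subfield `(F₁, O ∩ F₁)` admits relative local uniformization over `k` and `K = F₁(z)(η)` is a
Kaplansky–Hensel top over `F₁` (immediate, transcendental type, Hensel root), then `(K, O)` admits relative
local uniformization over `k`.  Proof: (hB) for `O ∩ F₁` by `regularBase_of_relLU`; every finite
`Z ⊆ O ∩ F₁(z)` is smoothly `O ∩ F₁`-uniformizable by KK09 Lemma 3.9 (tree, PROVED); every finite `Z ⊆ O`
is smoothly `O ∩ F₁(z)`-uniformizable by KK09 Lemma 3.7 (tree, PROVED); KK09 Cor. 3.6 (tree, PROVED) stacks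
the two layers into (hF); KK09 Prop. 3.5 / Cor. 3.6 over the regular base (tree `stub_relLU_of_regularBase`)
concludes. [KnafKuhlmann2009, Lemma 3.9, Lemma 3.7, Cor. 3.6, Prop. 3.5] [folklore] -/
theorem relLU_of_khTop (O : ValuationSubring K) (F₁ : IntermediateField k K) (hF₁fg : F₁.FG)
    (hLU : RelLocalUniformization k F₁ (O.comap (algebraMap F₁ K))) (z η : K)
    (htrans : ∀ P : Polynomial K, (∀ i, P.coeff i ∈ F₁.toSubfield) → P.eval z = 0 → P = 0)
    (hval : ∀ w ∈ Subfield.closure ((F₁.toSubfield : Set K) ∪ {z}), w ≠ 0 →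
      ∃ b ∈ F₁.toSubfield, O.valuation w = O.valuation b)
    (hres : ∀ w ∈ Subfield.closure ((F₁.toSubfield : Set K) ∪ {z}), w ∈ O →
      ∃ c ∈ F₁.toSubfield, O.valuation (w - c) < 1)
    (h3 : ∀ g : Polynomial K, (∀ i, g.coeff i ∈ F₁.toSubfield) →
      ∃ a₀ ∈ F₁.toSubfield, ∃ α : O.ValueGroup, ∀ a ∈ F₁.toSubfield,
        O.valuation (z - a) ≤ O.valuation (z - a₀) → O.valuation (g.eval a) = α)
    (hηO : η ∈ O)
    (hgen : Subfield.closure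
      (((Subfield.closure ((F₁.toSubfield : Set K) ∪ {z}) : Subfield K) : Set K) ∪ {η}) = ⊤)
    (f : Polynomial K) (hfmon : f.Monic)
    (hfcoeff : ∀ i, f.coeff i ∈ O ∧ f.coeff i ∈ Subfield.closure ((F₁.toSubfield : Set K) ∪ {z}))
    (hfη : f.eval η = 0) (hfder : O.valuation ((Polynomial.derivative f).eval η) = 1) :
    RelLocalUniformization k K O := by
  classical
  intro R hR hfrac hRO
  have hk : ∀ c : k, algebraMap k K c ∈ O := algebraMap_mem_of_le O R hRO
  haveI := hfrac
  have hkF₁ : (algebraMap k K).fieldRange ≤ F₁.toSubfield := by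
    intro x hx
    obtain ⟨c, rfl⟩ := RingHom.mem_fieldRange.mp hx
    exact (IntermediateField.mem_toSubfield _ _).mpr (F₁.algebraMap_mem c)
  have hB := regularBase_of_relLU O hk F₁ hF₁fg hLU
  set L : Subfield K := Subfield.closure ((F₁.toSubfield : Set K) ∪ {z}) with hLdef
  have hKL : F₁.toSubfield ≤ L := fun c hc => Subfield.subset_closure (Or.inl hc)
  have hLtop : L ≤ (⊤ : Subfield K) := le_top
  -- layer `F₁(z) | F₁`: KK09 Lemma 3.9 (immediate, transcendental type)
  have hLZ : ∀ Z : Finset K, (∀ w ∈ Z, w ∈ O ∧ w ∈ L) →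
      IsSmoothlyUniformizableIn ↥(O.toSubring ⊓ F₁.toSubfield.toSubring) O L (Z : Set K) :=
    fun Z hZ => isSmoothlyUniformizableIn_of_immediate_of_kaplansky O F₁.toSubfield htrans hval hres h3 Z hZ
  -- layer `K | F₁(z)`: KK09 Lemma 3.7 (Hensel root)
  have hFZ : ∀ Z : Finset K, (∀ w ∈ Z, w ∈ O ∧ w ∈ (⊤ : Subfield K)) →
      IsSmoothlyUniformizableIn ↥(O.toSubring ⊓ L.toSubring) O ⊤ (Z : Set K) :=
    fun Z hZ => isSmoothlyUniformizableIn_of_henselRoot O L ⊤ hηO hgen f hfmon hfcoeff hfη hfder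
      (Z : Set K) (fun w hw => hZ w (Finset.mem_coe.mp hw))
  -- KK09 Cor. 3.6 stacks the layers
  have hF : ∀ Z : Finset K, (∀ z ∈ Z, z ∈ O) →
      IsSmoothlyUniformizableIn ↥(O.toSubring ⊓ F₁.toSubfield.toSubring) O ⊤ (Z : Set K) :=
    fun Z hZ => knafKuhlmann2009_cor36 O hKL hLtop hLZ hFZ Z (fun w hw => ⟨hZ w hw, Subfield.mem_top w⟩)
  obtain ⟨A, h, hRA, hAfg, -, hreg⟩ :=
    stub_relLU_of_regularBase k K O hk F₁.toSubfield hkF₁ hB hF R hR hRO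
  exact ⟨A, h, hRA, hAfg, hreg⟩

/-- The law applied to the datum: RelLU of every finitely generated subfield of transcendence degree `≤ c`
(rung `c`, any characteristic bookkeeping done by the caller) decides every Kaplansky–Hensel top. [folklore] -/
theorem relLU_of_khTopBelow (O : ValuationSubring K) {c : ℕ}
    (hL : ∀ F₁ : IntermediateField k K, F₁.FG → Algebra.trdeg k F₁ ≤ c →
      RelLocalUniformization k F₁ (O.comap (algebraMap F₁ K)))
    (hD : KHTopBelow k O c) : RelLocalUniformization k K O := by
  obtain ⟨F₁, z, η, hfg, htr, htrans, hval, hres, h3, hηO, hgen, f, hfmon, hfcoeff, hfη, hfder⟩ := hD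
  exact relLU_of_khTop O F₁ hfg (hL F₁ hfg htr) z η htrans hval hres h3 hηO hgen f hfmon hfcoeff hfη hfder

end Kaplansky

end Summit.ResolutionOfSingularities.ResolutionOfSingularities.Theorems.KaplanskyLadder
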